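import Literature.IUT.HodgeTheaters.StableCurveTemperedDataOfSpecialFibreCuspedPiDataNV
import Literature.AnabelianGeometry.SemiGraphs.TemperedSpecialFibreTowerPiDataNonVacuityExposed
import HarnessLib

/-!
# The cusped free-profinite `PiData` witness WITH ITS FIBRES EXPOSED — the joint non-vacuity of
# `{PiData, FiniteLevels, a cusp, hTF, hab, hadm}` re-exported with the one-vertex structure of the special fibres
# ([IUTchI] Prop. 2.4 (i) p. 50; [SemiAnbd] §6 p. 71, Ex. 3.10 p. 44)

S. Mochizuki, *Inter-universal Teichmüller theory I*, kurims manuscript (May 2020), §2, Prop. 2.4 p. 50 and Cor. 2.5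
p. 51 [cite: Mochizuki2012, Prop 2.4(i) p.50] (D-0012 claim key; nothing of the series is asserted here);
S. Mochizuki, *Semi-graphs of anabelioids*, Publ. RIMS **42** (2006), §6 p. 71 (cusps: "`I_x := D_x ∩ Δ^temp_X` is
isomorphic to `Ẑ(1)`"), Ex. 3.10 p. 44 (the special-fibre tower) [cite: MochizukiSemiAnbd2006, §6 p.71].

PROOF-ONLY non-vacuity file (abc-iut cell, L5 [IUTchI] §2 lineage, row «SEC2-ONECALL-(ii)-SIDE-NV» part (F1); no
definition, no instance, no notation, no new `Prop` fact; the frozen interfaces `TemperedCurve` / `GroupLevelData` /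
`SpecialFibreData` / `SpecialFibreTower.PiData` are imported, never restated; the landed parent
`StableCurveTemperedDataOfSpecialFibreCuspedPiDataNV.lean` (abc-iut-f-193, p462496) is NOT edited — its public
`exists_closed_procyclic_axis_freeProfiniteTwo` is consumed by name, its three private transport helpers are copied).

WHY.  The §2 one-call `StableCurveTemperedData.OfSpecialFibre.prop24_cor25_ofPiData_byName_noRF` (abc-iut-L5-t11,
p467772) takes, besides the laws `hTF · hab · hadm` inhabited by p462496, per-level IDENTIFICATION data (`σ_i`, `Λv`,
`hvert`, `hΛv`), the (A3) law `hNN_i`, per-level `DecompositionData` with `hI_j`, and `hA3ar_j` — all of which read the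
FIBRES `T.Gc i` / charts `T.chart i` of the tower, which the parent's `∃ X d S T, …` hides (abc-iut-L5-t11 gen 8, (D1)).
abc-iut-L3-t3's `SpecialFibreTower.PiData.nonempty_of_charLevels_exposed` (p472109) re-runs abc-iut-L3-t2's builder with
the fibre structure EXPOSED.  This file re-runs the parent's three theorems with that ONE call swapped:

* `SpecialFibreTower.PiData.exists_temperedCurve_of_charLevels_cusped_exposed` — the parent's cusped §6 datum
  (`K := ℚ_p`, `Π^temp := G_{ℚ_p} × A`, ONE closed point, a CUSP, `D_x := G_{ℚ_p} × Z`) for every slim infinite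
  second-countable profinite `A` with characteristic levels `M` and a closed `Z ≃ₜ* Ẑ`, now exported WITH: `Π^temp` is
  COMPACT; `S.admissible` has trivial kernel; (E1) every fibre `𝒢_i` and the base `𝒢^c` has exactly one vertex, no
  edge, no branch; (E2) `⊤` is a verticial subgroup of every chart at every vertex, and the only one;
* `SpecialFibreTower.PiData.exists_temperedCurve_freeProfiniteTwo_cusped_exposed` — at `A := F̂₂` (characteristic open
  cores of abc-iut-w4-d053, procyclic axis `îa(Ẑ)` of the parent);
* `StableCurveTemperedData.OfSpecialFibre.exists_piData_cusp_torsionFreeAb_ab_adm_exposed` — **JOINT NON-VACUITY of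
  `{PiData, FiniteLevels, a CUSP, hTF, hab, hadm}` TOGETHER WITH `CompactSpace Π^temp`, (E1), (E2)** — the input of
  part (F2) (`StableCurveTemperedDataOfSpecialFibreSec2OneCallNV.lean`), where the remaining one-call binders are
  inhabited at this datum.

THE CONJUNCT `CompactSpace X.PiTemp` is a PROVED feature of this MODEL (its tempered group `G_{ℚ_p} × A` is profinite),
exported because part (F2) uses it to see that the completion maps `ι` are onto; it is NOT a statement of print — a
genuine `Π^tp_X` of [IUTchI] §2 is not compact.

HONEST LIMITS (abc-iut-L3-t2's, abc-iut-f-193's, verbatim in substance): consistency evidence for OUR binders only —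
`Π^temp` is a direct product and profinite (a genuine `Π^tp_X` is neither), there is exactly one closed point, the
fibres are one-vertex semi-graphs of anabelioids with trivial graph actions, the admissible kernels are `1`, and the
cuspidal inertia is topologically generated by the image of a free GENERATOR of `F₂`; NOT André's `π₁^temp` of a curve,
no curve is asserted to realise the datum.  Nothing here bears on [IUTchIII] Cor. 3.12; typed ≠ inhabited ≠ discharged.
-/

noncomputable section

namespace Literature.AnabelianGeometry.SemiGraphs

open _root_.Topology _root_.Function
open Literature.AlgebraicGeometry.Frobenioids (IsSlimGroup)
open Literature.AnabelianGeometry.AbsoluteAnabelian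
open Literature.IUT.HodgeTheaters (profiniteCompletion toCompletion toCompletion_int_injective)
open ProfiniteSemiGraph

namespace SpecialFibreTower

variable (p : ℕ) [Fact p.Prime]

/-! ### 1. Transport bookkeeping (private copies of the parent's private helpers) -/

/-- Slimness is transported along isomorphisms of topological groups. [cite: MochizukiSemiAnbd2006, §0 p.6] -/
private theorem isSlimGroup_transport_exposed {G₁ G₂ : Type*} [Group G₁] [TopologicalSpace G₁]
    [Group G₂] [TopologicalSpace G₂] (e : G₁ ≃ₜ* G₂) (h : IsSlimGroup G₁) : IsSlimGroup G₂ := by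
  refine ⟨fun H hH => ?_⟩
  refine (Subgroup.eq_bot_iff_forall _).mpr fun z hz => ?_
  have hH' : IsOpen ((H.comap e.toMulEquiv.toMonoidHom : Subgroup G₁) : Set G₁) :=
    hH.preimage e.continuous
  have hz' : e.symm z ∈ Subgroup.centralizer ((H.comap e.toMulEquiv.toMonoidHom : Subgroup G₁) : Set G₁) := by
    refine Subgroup.mem_centralizer_iff.mpr fun g hg => ?_
    have := Subgroup.mem_centralizer_iff.mp hz (e g) hg
    apply e.injective
    simpa [map_mul] using this
  rw [h.centralizer_eq_bot _ hH'] at hz'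
  have : e.symm z = 1 := Subgroup.mem_bot.mp hz'
  simpa using congrArg e this

/-- The subgroup `1 × A ≤ G × A` (membership condition `x.1 = 1`) is `A` as a topological group, via `z ↦ (1, z)`.
[cite: MochizukiSemiAnbd2006, §6 p.69] -/
private theorem exists_equiv_of_fst_eq_one_exposed {G A : Type*} [Group G] [TopologicalSpace G]
    [Group A] [TopologicalSpace A] (H : Subgroup (G × A)) (hH : ∀ x, x ∈ H ↔ x.1 = 1) :
    ∃ e : A ≃ₜ* H, ∀ z, ((e z : H) : G × A) = (1, z) :=
  ⟨{ toFun := fun z => ⟨(1, z), (hH _).2 rfl⟩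
     invFun := fun y => y.1.2
     left_inv := fun _ => rfl
     right_inv := fun y => by
       apply Subtype.ext
       exact Prod.ext ((hH _).1 y.2).symm rfl
     map_mul' := fun z w => Subtype.ext (Prod.ext (by simp) rfl)
     continuous_toFun := (continuous_const.prodMk continuous_id).subtype_mk _
     continuous_invFun := continuous_snd.comp continuous_subtype_val }, fun _ => rfl⟩

/-- Antitone characteristic cofinal families of open normal finite-index subgroups are transported along isomorphisms
of topological groups (image family). [cite: MochizukiSemiAnbd2006, Ex 3.10 p.44] -/
private theorem charLevels_map_exposed {A B : Type*} [Group A] [TopologicalSpace A] [Group B] [TopologicalSpace B]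
    (e : A ≃ₜ* B) (M : ℕ → Subgroup A) (hanti : Antitone M) (hopen : ∀ i, IsOpen (M i : Set A))
    (hchar : ∀ (i) (φ : A ≃ₜ* A), (M i).map φ.toMulEquiv.toMonoidHom = M i) (hnormal : ∀ i, (M i).Normal)
    (hfi : ∀ i, (M i).FiniteIndex)
    (hcof : ∀ U : Subgroup A, IsOpen (U : Set A) → U.Normal → U.FiniteIndex → ∃ i, M i ≤ U) :
    Antitone (fun i => (M i).map e.toMulEquiv.toMonoidHom) ∧
      (∀ i, IsOpen (((M i).map e.toMulEquiv.toMonoidHom : Subgroup B) : Set B)) ∧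
      (∀ (i) (φ : B ≃ₜ* B), ((M i).map e.toMulEquiv.toMonoidHom).map φ.toMulEquiv.toMonoidHom =
        (M i).map e.toMulEquiv.toMonoidHom) ∧
      (∀ i, ((M i).map e.toMulEquiv.toMonoidHom).Normal) ∧
      (∀ i, ((M i).map e.toMulEquiv.toMonoidHom).FiniteIndex) ∧
      ∀ U : Subgroup B, IsOpen (U : Set B) → U.Normal → U.FiniteIndex →
        ∃ i, (M i).map e.toMulEquiv.toMonoidHom ≤ U := by
  refine ⟨fun i j hij => Subgroup.map_mono (hanti hij), fun i => ?_, fun i φ => ?_, fun i => ?_, fun i => ?_,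
    fun U hU hUn hUf => ?_⟩
  · rw [Subgroup.coe_map]
    exact e.toHomeomorph.isOpenMap _ (hopen i)
  · let ψ : A ≃ₜ* A := e.trans (φ.trans e.symm)
    have hcomp : e.toMulEquiv.toMonoidHom.comp ψ.toMulEquiv.toMonoidHom =
        φ.toMulEquiv.toMonoidHom.comp e.toMulEquiv.toMonoidHom :=
      MonoidHom.ext fun a => e.apply_symm_apply (φ (e a))
    calc ((M i).map e.toMulEquiv.toMonoidHom).map φ.toMulEquiv.toMonoidHom
        = (M i).map (φ.toMulEquiv.toMonoidHom.comp e.toMulEquiv.toMonoidHom) := Subgroup.map_map _ _ _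
      _ = (M i).map (e.toMulEquiv.toMonoidHom.comp ψ.toMulEquiv.toMonoidHom) := by rw [hcomp]
      _ = ((M i).map ψ.toMulEquiv.toMonoidHom).map e.toMulEquiv.toMonoidHom := (Subgroup.map_map _ _ _).symm
      _ = (M i).map e.toMulEquiv.toMonoidHom := by rw [hchar i ψ]
  · exact (hnormal i).map _ e.surjective
  · have hidx : ((M i).map e.toMulEquiv.toMonoidHom).index = (M i).index :=
      Subgroup.index_map_of_bijective (f := e.toMulEquiv.toMonoidHom) e.bijective (M i)
    exact ⟨by rw [hidx]; exact (hfi i).index_ne_zero⟩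
  · have hU' : IsOpen ((U.comap e.toMulEquiv.toMonoidHom : Subgroup A) : Set A) := hU.preimage e.continuous
    haveI : (U.comap e.toMulEquiv.toMonoidHom).Normal := hUn.comap _
    have hidx : (U.comap e.toMulEquiv.toMonoidHom).index = U.index :=
      U.index_comap_of_surjective (f := e.toMulEquiv.toMonoidHom) e.surjective
    haveI : (U.comap e.toMulEquiv.toMonoidHom).FiniteIndex := ⟨by rw [hidx]; exact hUf.index_ne_zero⟩
    obtain ⟨i, hi⟩ := hcof _ hU' inferInstance inferInstance
    exact ⟨i, Subgroup.map_le_iff_le_comap.mpr hi⟩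

/-! ### 2. The cusped builder with exposed fibres -/

/-- **`SpecialFibreTower.PiData` INHABITED at the cusped §6 datum, FIBRES EXPOSED**: the parent's
`PiData.exists_temperedCurve_of_charLevels_cusped` (`K := ℚ_p`, `Π^temp := G_{ℚ_p} × A`, ONE closed point, a CUSP,
`D_x := G_{ℚ_p} × Z`, `I_x = 1 × Z ≅ Ẑ`; levels = transported `M_i`, admissible kernels `1`) with abc-iut-L3-t2's call
replaced by abc-iut-L3-t3's `PiData.nonempty_of_charLevels_exposed`, exporting in addition: `Π^temp` is compact,
`Ker(S.admissible) = 1`, (E1) the fibres `𝒢_i` and the base `𝒢^c` are one-vertex / edgeless / branchless, (E2) `⊤` is a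
(the) verticial subgroup of every chart.  Consistency evidence only; not a curve.
[cite: MochizukiSemiAnbd2006, §6 p.71] -/
theorem PiData.exists_temperedCurve_of_charLevels_cusped_exposed (A : Type) [Group A] [TopologicalSpace A]
    [IsTopologicalGroup A] [CompactSpace A] [TotallyDisconnectedSpace A] [SecondCountableTopology A] [Infinite A]
    (hslim : IsSlimGroup A) (M : ℕ → Subgroup A) (hanti : Antitone M) (hopen : ∀ i, IsOpen (M i : Set A))
    (hchar : ∀ (i) (φ : A ≃ₜ* A), (M i).map φ.toMulEquiv.toMonoidHom = M i) (hnormal : ∀ i, (M i).Normal)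
    (hfi : ∀ i, (M i).FiniteIndex)
    (hcof : ∀ U : Subgroup A, IsOpen (U : Set A) → U.Normal → U.FiniteIndex → ∃ i, M i ≤ U)
    (Z : Subgroup A) (hZ : IsClosed (Z : Set A)) (eZ : Z ≃ₜ* ZHat) :
    ∃ (X : TemperedCurve p) (d : X.GroupLevelData) (S : SpecialFibreData (X.toTemperedArithmeticGroup d))
      (T : SpecialFibreTower X.DeltaTemp),
      X.K = ⊥ ∧ Function.Surjective X.aug ∧ (∃ x : X.Pt, X.IsCusp x) ∧ (∀ x : X.Pt, X.IsCusp x) ∧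
        (∃ e : A ≃ₜ* X.DeltaTemp, (∀ i, T.N i = (M i).map e.toMulEquiv.toMonoidHom) ∧
          ∀ x : X.Pt, X.inertia x = ((Z.map e.toMulEquiv.toMonoidHom).map X.DeltaTemp.subtype)) ∧
        (∀ i, T.admKer i = ⊥) ∧ S.admissible.toMonoidHom.ker = ⊥ ∧ FiniteLevels X d S T ∧
        Nonempty (PiData X d S T) ∧ CompactSpace X.PiTemp ∧
        ((∀ i, Nonempty (Unique (T.Gc i).graph.Vertex)) ∧ (∀ i, IsEmpty (T.Gc i).graph.Edge) ∧
          (∀ i, IsEmpty (T.Gc i).graph.Branch) ∧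
          Nonempty (Unique S.Gc.graph.Vertex) ∧ IsEmpty S.Gc.graph.Edge ∧ IsEmpty S.Gc.graph.Branch) ∧
        ((∀ i v, (⊤ : Subgroup (T.chart i).G) ∈ verticialSubgroups (T.chart i) v) ∧
          (∀ v, (⊤ : Subgroup S.chart.G) ∈ verticialSubgroups S.chart v) ∧
          (∀ i v, verticialSubgroups (T.chart i) v = {⊤}) ∧
          (∀ v, verticialSubgroups S.chart v = {⊤})) := by
  classical
  haveI : IsGalois ℚ_[p] (AlgebraicClosure ℚ_[p]) := {}
  haveI : T2Space (GQp p) := krullTopology_t2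
  let fstH : GQp p × A →ₜ* GQp p := ContinuousMonoidHom.fst _ _
  let D : Subgroup (GQp p × A) := (⊤ : Subgroup (GQp p)).prod Z
  have hDmem : ∀ x : GQp p × A, x ∈ D ↔ x.2 ∈ Z := fun x => by simp [D, Subgroup.mem_prod]
  have hDclosed : IsClosed (D : Set (GQp p × A)) := by
    have : (D : Set (GQp p × A)) = Prod.snd ⁻¹' (Z : Set A) := by
      ext x; exact hDmem x
    rw [this]; exact hZ.preimage continuous_snd
  have hfstD : fstH '' (D : Set (GQp p × A)) = Set.univ :=
    Set.eq_univ_of_forall fun g => ⟨(g, 1), (hDmem _).2 Z.one_mem, rfl⟩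
  have hinertia : Nonempty (↥(D ⊓ fstH.toMonoidHom.ker) ≃ₜ* ZHat) := by
    refine ⟨ContinuousMulEquiv.trans ?_ eZ⟩
    exact
      { toFun := fun x => ⟨x.1.2, (hDmem _).1 (Subgroup.mem_inf.1 x.2).1⟩
        invFun := fun z => ⟨(1, (z : A)), (hDmem _).2 z.2, (MonoidHom.mem_ker).2 rfl⟩
        left_inv := fun x => by
          obtain ⟨⟨g, z⟩, hgz⟩ := x
          have hg : g = 1 := (MonoidHom.mem_ker).1 (Subgroup.mem_inf.1 hgz).2
          apply Subtype.ext
          change ((1 : GQp p), z) = (g, z)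
          rw [hg]
        right_inv := fun z => rfl
        map_mul' := fun x y => Subtype.ext rfl
        continuous_toFun := (continuous_snd.comp continuous_subtype_val).subtype_mk _
        continuous_invFun := (continuous_const.prodMk continuous_subtype_val).subtype_mk _ }
  let X : TemperedCurve p :=
    { K := ⊥
      finiteDimensional_K := inferInstance
      PiTemp := GQp p × A
      aug := fstH
      range_aug := by
        rw [IntermediateField.fixingSubgroup_bot]
        exact MonoidHom.range_eq_top.mpr Prod.fst_surjective
      PiHat := GQp p × A
      toHat := ContinuousMonoidHom.id _
      isProfiniteCompletion_toHat := isProfiniteCompletion_id _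
      toHat_injective := Function.injective_id
      augHat := fstH
      augHat_comp := fun _ => rfl
      Pt := Unit
      IsCusp := fun _ => True
      decomp := fun _ => D
      isClosed_decomp := fun _ => hDclosed
      isOpen_aug_decomp := fun _ => by
        change IsOpen (fstH '' (D : Set (GQp p × A)))
        rw [hfstD]; exact isOpen_univ
      inertia_eq_bot := fun _ h => (h trivial).elim
      inertia_equiv_zHat := fun _ _ => hinertia }
  have hT : IsTempered (GQp p × A) := IsTempered.of_profinite
  have hslimG : IsSlimGroup (GQp p) :=
    IsSubpadicFor.isSlimGroup_absoluteGaloisGroup (AbsTopIII.IsSubpadicFor.padic p)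
  have hslimPi : IsSlimGroup (GQp p × A) := isSlimGroup_prod_of_profinite hslimG hslim
  haveI hscG : SecondCountableTopology (GQp p) :=
    Literature.NumberTheory.LocalFields.secondCountableTopology_galQp p
  have hsc : SecondCountableTopology (GQp p × A) := inferInstance
  have hΔmem : ∀ x : GQp p × A, x ∈ X.DeltaTemp ↔ x.1 = 1 := fun x => MonoidHom.mem_ker
  obtain ⟨e, he⟩ := exists_equiv_of_fst_eq_one_exposed X.DeltaTemp hΔmem
  let ιG := X.galoisIdentification
  have hkermem : ∀ x : GQp p × A, x ∈ (X.augK ιG).toMonoidHom.ker ↔ x.1 = 1 := fun x => by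
    rw [TemperedCurve.ker_augK]; exact hΔmem x
  have hkerClosed : IsClosed (((X.augK ιG).toMonoidHom.ker : Subgroup (GQp p × A)) : Set (GQp p × A)) := by
    have : (((X.augK ιG).toMonoidHom.ker : Subgroup (GQp p × A)) : Set (GQp p × A)) = Prod.fst ⁻¹' {1} := by
      ext x; exact hkermem x
    rw [this]; exact isClosed_singleton.preimage continuous_fst
  have hslimKer : IsSlimGroup (X.augK ιG).toMonoidHom.ker := by
    obtain ⟨eK, -⟩ := exists_equiv_of_fst_eq_one_exposed _ hkermem
    exact isSlimGroup_transport_exposed eK hslim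
  let d : X.GroupLevelData :=
    { galEquiv := ιG
      isTempered := hT
      isTempered_ker := hT.subgroup_of_isClosed _ hkerClosed
      isSlimGroup := hslimPi
      isSlimGroup_ker := hslimKer
      secondCountableTopology := hsc }
  obtain ⟨hNanti, hNopen, hNchar, hNnormal, hNfi, hNcof⟩ :=
    charLevels_map_exposed e M hanti hopen hchar hnormal hfi hcof
  have hinf : Infinite X.DeltaTemp := Infinite.of_injective e e.injective
  haveI hcptPi : CompactSpace X.PiTemp := (inferInstance : CompactSpace (GQp p × A))
  haveI : TotallyDisconnectedSpace X.PiTemp := (inferInstance : TotallyDisconnectedSpace (GQp p × A))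
  -- THE swapped call (abc-iut-L3-t3, p472109): the builder with the fibre structure exposed
  obtain ⟨S, T, hTN, hadm, hSker, hF, hP, hUV, hE, hB, hUV₀, hE₀, hB₀, htop, htop₀, hVeq, hVeq₀⟩ :=
    PiData.nonempty_of_charLevels_exposed X d hinf
      (fun i => (M i).map e.toMulEquiv.toMonoidHom) hNanti hNopen hNchar hNnormal hNfi hNcof
  have hIx : ∀ x : X.Pt, X.inertia x = ((Z.map e.toMulEquiv.toMonoidHom).map X.DeltaTemp.subtype) := by
    intro x
    ext ⟨g, z⟩
    constructor
    · intro hgz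
      have hz : z ∈ Z := (hDmem _).1 (Subgroup.mem_inf.1 hgz).1
      have hg : g = 1 := (hΔmem _).1 (Subgroup.mem_inf.1 hgz).2
      refine ⟨e z, ⟨z, hz, rfl⟩, ?_⟩
      subst hg
      exact he z
    · rintro ⟨y, ⟨w, hw, rfl⟩, hy⟩
      have hy' : ((1 : GQp p), (w : A)) = (g, z) := (he w).symm.trans hy
      refine Subgroup.mem_inf.2 ⟨(hDmem _).2 ?_, (hΔmem _).2 ?_⟩
      · have : z = w := (congrArg Prod.snd hy').symm
        rw [this]; exact hw
      · exact (congrArg Prod.fst hy').symm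
  exact ⟨X, d, S, T, rfl, Prod.fst_surjective, ⟨(), trivial⟩, fun _ => trivial,
    ⟨e, fun i => by rw [hTN], hIx⟩, hadm, hSker, hF, hP, hcptPi,
    ⟨hUV, hE, hB, hUV₀, hE₀, hB₀⟩, ⟨htop, htop₀, hVeq, hVeq₀⟩⟩

/-! ### 3. At `A := F̂₂` -/

/-- **`SpecialFibreTower.PiData` INHABITED at `Π^temp := G_{ℚ_p} × F̂₂` WITH A CUSP, FIBRES EXPOSED**, for every prime
`p`: the parent's `PiData.exists_temperedCurve_freeProfiniteTwo_cusped` (levels = the transported characteristic open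
cores `charOpenCore F̂₂ i`, cusp axis `îa(Ẑ)`) through the exposed builder: additionally `Π^temp` compact,
`Ker(S.admissible) = 1`, (E1) one-vertex edgeless branchless fibres and base, (E2) `⊤` the (only) verticial subgroup of
every chart.  Consistency evidence only; not a curve. [cite: MochizukiSemiAnbd2006, Ex 3.10 p.44] -/
theorem PiData.exists_temperedCurve_freeProfiniteTwo_cusped_exposed :
    ∃ (X : TemperedCurve p) (d : X.GroupLevelData) (S : SpecialFibreData (X.toTemperedArithmeticGroup d))
      (T : SpecialFibreTower X.DeltaTemp),
      X.K = ⊥ ∧ Function.Surjective X.aug ∧ (∃ x : X.Pt, X.IsCusp x) ∧ (∀ x : X.Pt, X.IsCusp x) ∧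
        (∃ (e : profiniteCompletion (FreeGroup (Fin 2)) ≃ₜ* X.DeltaTemp)
            (Z : Subgroup (profiniteCompletion (FreeGroup (Fin 2)))),
          (∀ i, T.N i = (charOpenCore (profiniteCompletion (FreeGroup (Fin 2))) i).map e.toMulEquiv.toMonoidHom) ∧
          Nonempty (Z ≃ₜ* ZHat) ∧ toCompletion (FreeGroup (Fin 2)) (FreeGroup.of 0) ∈ Z ∧
          ∀ x : X.Pt, X.inertia x = ((Z.map e.toMulEquiv.toMonoidHom).map X.DeltaTemp.subtype)) ∧
        (∀ i, T.admKer i = ⊥) ∧ S.admissible.toMonoidHom.ker = ⊥ ∧ FiniteLevels X d S T ∧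
        Nonempty (PiData X d S T) ∧ CompactSpace X.PiTemp ∧
        ((∀ i, Nonempty (Unique (T.Gc i).graph.Vertex)) ∧ (∀ i, IsEmpty (T.Gc i).graph.Edge) ∧
          (∀ i, IsEmpty (T.Gc i).graph.Branch) ∧
          Nonempty (Unique S.Gc.graph.Vertex) ∧ IsEmpty S.Gc.graph.Edge ∧ IsEmpty S.Gc.graph.Branch) ∧
        ((∀ i v, (⊤ : Subgroup (T.chart i).G) ∈ verticialSubgroups (T.chart i) v) ∧
          (∀ v, (⊤ : Subgroup S.chart.G) ∈ verticialSubgroups S.chart v) ∧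
          (∀ i v, verticialSubgroups (T.chart i) v = {⊤}) ∧
          (∀ v, verticialSubgroups S.chart v = {⊤})) := by
  haveI : SecondCountableTopology (profiniteCompletion (FreeGroup (Fin 2))) :=
    secondCountableTopology_profiniteCompletion_freeGroup (Fin 2)
  haveI : Infinite (profiniteCompletion (FreeGroup (Fin 2))) := infinite_profiniteCompletion_freeGroupTwo
  obtain ⟨Z, hZ, ⟨eZ⟩, haZ⟩ := exists_closed_procyclic_axis_freeProfiniteTwo
  obtain ⟨hanti, hlev, hcof⟩ := charOpenCore_family_of_tfg (Γ := profiniteCompletion (FreeGroup (Fin 2)))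
    isTopologicallyFinitelyGenerated_profiniteCompletion_freeGroupTwo
  obtain ⟨X, d, S, T, hK, haug, hx, hcusp, ⟨e, hN, hI⟩, hadm, hSker, hF, hP, hcpt, hE1, hE2⟩ :=
    PiData.exists_temperedCurve_of_charLevels_cusped_exposed p (profiniteCompletion (FreeGroup (Fin 2)))
      isSlimGroup_profiniteCompletion_freeGroupTwo (charOpenCore _) hanti (fun i => (hlev i).1)
      (fun i φ => (hlev i).2.2.2 φ.toMulEquiv φ.continuous φ.symm.continuous) (fun i => (hlev i).2.1)
      (fun i => (hlev i).2.2.1) (fun U hU _ hUf => hcof U hU hUf) Z hZ eZ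
  exact ⟨X, d, S, T, hK, haug, hx, hcusp, ⟨e, Z, hN, ⟨eZ⟩, haZ, hI⟩, hadm, hSker, hF, hP, hcpt, hE1, hE2⟩

end SpecialFibreTower

end Literature.AnabelianGeometry.SemiGraphs

/-! ### 4. Joint non-vacuity of `{PiData, FiniteLevels, a CUSP, hTF, hab, hadm}` with the fibres exposed -/

namespace Literature.IUT.HodgeTheaters

open _root_.Topology
open Literature.AnabelianGeometry.SemiGraphs Literature.AnabelianGeometry.SemiGraphs.ProfiniteSemiGraph

namespace StableCurveTemperedData

namespace OfSpecialFibre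

/-- **JOINT NON-VACUITY of `{PiData, FiniteLevels, a CUSP x, hTF, hab, hadm}` WITH THE FIBRES EXPOSED** at the cusped
free-profinite witness (`Π^temp := G_{ℚ_p} × F̂₂`, `K := ℚ_p`, `Δ̂_X ≅ F̂₂`, ONE closed point which is a cusp, admissible
kernels `1`, every `p`): the parent's `exists_piData_cusp_torsionFreeAb_ab_adm` (abc-iut-f-193) — `hTF` ([Config]
Rmk 1.2.2 printed form on `X.DeltaHat`), `hab` (every `Σ`), `hadm` — re-derived over the exposed builder and exported
TOGETHER WITH: `Π^temp_X` compact (a feature of the MODEL — its tempered group is profinite — not of print); (E1) every fibre `𝒢_i` of the tower has exactly one vertex, no edge, no branch;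
(E2) `⊤ ≤ π₁^temp(𝒢_i)` is a verticial subgroup of the chart at every vertex, and the only one.  These are exactly the
inputs from which part (F2) inhabits the remaining binders of the §2 one-call.  Consistency evidence for OUR binders;
not a curve. ([IUTchI] Prop 2.4(i) p.50) [claim: Mochizuki2012, status: disputed] -/
theorem exists_piData_cusp_torsionFreeAb_ab_adm_exposed (p : ℕ) [Fact p.Prime] :
    ∃ (X : TemperedCurve p) (d : X.GroupLevelData) (S : SpecialFibreData (X.toTemperedArithmeticGroup d))
      (T : SpecialFibreTower X.DeltaTemp),
      Nonempty (SpecialFibreTower.PiData X d S T) ∧ SpecialFibreTower.FiniteLevels X d S T ∧ X.K = ⊥ ∧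
        Nonempty {x : X.Pt // X.IsCusp x} ∧ (∀ i, T.admKer i = ⊥) ∧
        (∀ H : Subgroup X.DeltaHat, IsOpen (H : Set X.DeltaHat) → ∀ (h : H) (n : ℕ), n ≠ 0 →
            SigmaCharDetects Set.univ H h → SigmaCharDetects Set.univ H (h ^ n)) ∧
        (∀ (Sigma : Set ℕ) (i : ℕ) (A : Type) [CommGroup A] [Finite A] (χ : T.N i →* A),
            IsOpen ((χ.ker : Subgroup (T.N i)) : Set (T.N i)) →
            (∀ q : ℕ, q.Prime → q ∣ Nat.card A → q ∈ Sigma) → (T.adm i).toMonoidHom.ker ≤ χ.ker) ∧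
        (∀ U ∈ 𝓝 (1 : ↥X.DeltaTemp), ∃ j, ((T.admKer j : Subgroup ↥X.DeltaTemp) : Set ↥X.DeltaTemp) ⊆ U) ∧
        CompactSpace X.PiTemp ∧
        (∀ i, Nonempty (Unique (T.Gc i).graph.Vertex)) ∧ (∀ i, IsEmpty (T.Gc i).graph.Edge) ∧
        (∀ i, IsEmpty (T.Gc i).graph.Branch) ∧
        (∀ i v, (⊤ : Subgroup (T.chart i).G) ∈ verticialSubgroups (T.chart i) v) ∧
        (∀ i v, verticialSubgroups (T.chart i) v = {⊤}) := by
  obtain ⟨X, d, S, T, hK, -, ⟨x, hx⟩, -, ⟨e, -, -, -, -, -⟩, hadm, -, hF, hP, hcpt, ⟨hUV, hE, hB, -, -, -⟩,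
      ⟨htop, -, hVeq, -⟩⟩ :=
    SpecialFibreTower.PiData.exists_temperedCurve_freeProfiniteTwo_cusped_exposed p
  haveI : CompactSpace X.DeltaTemp := e.toHomeomorph.compactSpace
  obtain ⟨e₂⟩ := X.nonempty_continuousMulEquiv_deltaHat_of_compactSpace_deltaTemp
  refine ⟨X, d, S, T, hP, hF, hK, ⟨⟨x, hx⟩⟩, hadm, ?_, ?_, ?_, hcpt, hUV, hE, hB, htop, hVeq⟩
  · -- `hTF`: open subgroups of `F̂₂` have torsion-free abelianization (abc-iut-w4-d055), transported to `Δ̂_X`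
    exact torsionFreeAb_of_continuousMulEquiv (e.trans e₂)
      (fun H hH h n hn hdet =>
        ProfiniteCompletion.sigmaCharDetects_univ_pow_of_isFreeGroup (G := FreeGroup (Fin 2)) H hH h n hn hdet)
  · -- `hab`: the admissible kernels are `1`
    intro Sigma i A _ _ χ _ _
    rw [T.ker_adm i, hadm i, Subgroup.bot_subgroupOf]
    exact bot_le
  · -- `hadm`: idem
    intro U hU
    refine ⟨0, ?_⟩
    rw [hadm 0]
    intro y hy
    rw [SetLike.mem_coe, Subgroup.mem_bot] at hy
    rw [hy]
    exact mem_of_mem_nhds hU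

end OfSpecialFibre

end StableCurveTemperedData

end Literature.IUT.HodgeTheaters

end
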